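/-
Copyright (c) 2026 the pub-hodgecm-mathlib formalisation cell (harness21).  Prover seat hodgecm-mathlib-LH3-p02 (g4): line LH3 (closer stub `stub_N9`), LETTER L1 clause (I₁),
organ O-L1c FACES — the (I₁) relabel (F-rel) and the socket reduction (LH3-plan (g4) RULING #18: «(F′) CUT 2 on ★ (H-core)+(B-rel)»).
-/
import Literature.NumberTheory.Rogawski1990.ArchOrbFamGExtFaceJetInst        -- ★ p851180∕p851220 (this seat): `exists_nhds_bddAbove_norm_iteratedFDeriv_orbFamGExt_of_boxPackage`; brings `orbFamGExt`, `InRegG`, `RegG`, `hcSwapAt`, `slotSign`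
import Literature.NumberTheory.Rogawski1990.ArchOrbFamGExtSmoothInRegG      -- ★ (A5) p851150 (F0P3b-p01): `contDiffOn_orbFamGExt_inRegG` ((I₂): the family is `C^∞` on the open `InRegG`)
import Literature.NumberTheory.Rogawski1990.ArchTransfFamilyJumpPartners     -- ★ p850304 (LH7-p02 (g2)): `twisted_hcSwapAt_zero_one` and its tools `slotPerm_update_one`, `archERhoG_mul_archRG_slotPerm`, `prod_sign_update_swap_mul`
import Literature.NumberTheory.Rogawski1990.ArchJumpBricksOfSides            -- ★ `mem_splitChartPlaces_of_isIndefiniteAt` (a place with two slot signs is a split-chart place)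
import Literature.Analysis.Calculus.BoundedJetsLeibnizReflection             -- ★ (F0P3a-p02): `bddAbove_norm_iteratedFDeriv_mul`, `…_of_isCompact`, `…_comp_affine`
import Literature.NumberTheory.Automorphic.ArchSharedRankOneDatum              -- ★ p850571 (F0P3-p02): `sharedRankOneDatum_exists` (a two-sided Haar `μ₀` on the Cayley carrier `U(J)`) — EDITION 2
import Literature.NumberTheory.Rogawski1990.ArchDeltaTransferOfChartRead       -- ★ p850246: frame bridges `ne_zero_of_diagonal_anisotropic`, `complexConj_apply_eq_of_diagonal_frame` — EDITION 2
import HarnessLib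

/-!
# (I₁) AT THE FACES — THE RELABEL: bounded jets near a one-wall point of the wall `(w, 1, 2)` from the wall `(w, 0, 2)` across Harish-Chandra's compact reflection,
# and the reduction of the whole `hF` socket of ★ `smoothBounded_orbFamGExt_of_strata₄` to the `(0, 2)`-heads
# (Harish-Chandra (W); Shelstad 1979 §4 property (II), Lemma 4.3; Varadarajan 1977 I §1.12; Bouaziz 1994 §3.1–3.2)

Topic `NumberTheory/Rogawski1990`; namespace `Literature.NumberTheory.Rogawski1990`.  THEOREMS ONLY (no `def`, no instance, no notation, no axiom, no named fact, no `sorry`).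
Cell `pub/hodgecm-mathlib`, crux H413 (`stmt-HodgeConjecture-24833`), F0∕P3c line LH3 (closer stub `stub_N9`, DIRECT ROAD, leaf v5 `F0_P3c_StubN9Direct`), LETTER L1 clause (I₁),
organ **O-L1c `stub_N9hcFaceJetBounds` := `hF`** of ★ (I₁-asm) ED. 2 `smoothBounded_orbFamGExt_of_strata₄` (LH7-p04 (g4), p851201).  Seat LH3-p02 (g4) (the (F′) hand; RULING #18
«CUT 2 on ★ (H-core)+(B-rel)»: this file is the (I₁) edition of ★ (B-rel) `ArchHcJumpRelabel` (LH3-p03, p851032, which relabels JUMPS) — it relabels BOUNDS).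

THE MATHEMATICS.  The `hF` socket asks, at every admissible-or-junk label `S′`, every compact-chart place `w ∉ S′`, every NONCOMPACT pair `(i, j)` (`slotSign w i ≠ slotSign w j`)
and every one-wall point `x` of the wall `(w, i, j)`, for locally bounded jets of `orbFamGExt ν′ a′ S′` on `InRegG`.  On a junk label the family is `0` (★ `orbFamGExt_of_not_admissible`).
On an admissible label, a place with two slot signs is a split-chart place (★ `mem_splitChartPlaces_of_isIndefiniteAt`), where the house frame normalises the slot signs to
`(s, s, −s)` (★ `slotSign_of_mem_splitChartPlaces`): the noncompact pairs are `(0,2), (2,0), (1,2), (2,1)`, the compact pair is `(0,1)`.  The pairs `(0,2)∕(2,0)` are the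
`(0,2)`-heads (★ `…_of_hcSemireg`, ★ `…_of_boxPackage`, this seat); the pairs `(1,2)∕(2,1)` are carried onto them by the REALISED COMPACT REFLECTION `σ = hcSwapAt w 0 1`:
Harish-Chandra's (W) clause (★ `archHcWeyl_orbFamGExt`) with the alternation of the Weyl denominator gives `'F(σc) = −'F(c)` on the `G`-regular set (★ `twisted_hcSwapAt_zero_one`),
i.e. `F(c) = u(c)·F(σc)` with the GLOBAL smooth unit `u = −e^{ρ}∘σ ∕ e^{ρ}`; both sides are `C^∞` on the open `InRegG` (★ (A5) `contDiffOn_orbFamGExt_inRegG`; `σ` preserves `InRegG`,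
★ `hcSwapAt_mem_inRegG_iff`) and `RegG` is dense (★ `dense_regG`), so the identity holds on `InRegG` and the jets agree there; `σ` is a continuous linear automorphism
(★ `exists_continuousLinearEquiv_hcSwapAt`), so bounds near `σx` pull back (★ `bddAbove_norm_iteratedFDeriv_comp_affine`) and Leibniz with the unit (★ `bddAbove_norm_iteratedFDeriv_mul`)
finishes.
* §1 `twisted_hcSwapAt_of_slotSign_eq` — the flip for ANY same-sign transposition `(i k)` at `w₀ ∉ S` (★ `twisted_hcSwapAt_zero_one` is `(0 1)`).
* §2 **`exists_nhds_bddAbove_norm_iteratedFDeriv_of_twisted_flip`** — GENERIC TRANSPORT (any coordinate type `W`, any sign table `s`, one member `F` smooth on `InRegG s S′` flipping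
  under `hcSwapAt w i k` on `RegG S′`): bounds of orders `≤ n` near `hcSwapAt w i k p` ⇒ the order-`n` bound near `p`.
* §3 **`exists_nhds_bddAbove_norm_iteratedFDeriv_orbFamGExt_of_hcSwapAt`** — the genuine family (admissible `S`, `w ∉ S`, `slotSign w i = slotSign w k`).
* §4 **`faceJetBounds_of_wall02`** — THE SOCKET REDUCTION: the full `hF` text of ★ `smoothBounded_orbFamGExt_of_strata₄` (cube hypothesis and all) from the `(0,2)`-heads at
  admissible labels `h02 : ∀ S′ admissible, n, x, w ∉ S′, slotSign w 0 ≠ slotSign w 2, x w 0 = x w 2, e^{ix_{w,third}} ≠ e^{ix_{w0}}, (other places in-regular) ⊢ bound`.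
* §5 **`faceJetBounds_of_boxDescent`** — O-L1c FROM (B-desc′) ALONE: `hF` from the (B-desc′) HEAD SHAPE `hbox` (LH7-p02 (g4) ED. 2 `exists_descent_box_orbFamGExt_inRegG`, binders
  `S admissible, w₀ ∉ S split-chart, x w₀ 0 = x w₀ 2, e^{ix_{w₀1}} ≠ e^{ix_{w₀0}}, hxin ⊢ ∃ K U f, 8 clauses` = ★ p851168's conclusion): §4 ∘ ★ `…_of_boxPackage`.  So the leaf pays
  O-L1c by `faceJetBounds_of_boxDescent L α ν′ a′ hα hreal hJ μ₀ (fun S hS w₀ hw₀ hwsp x hx02 hx1 hxin => exists_descent_box_orbFamGExt_inRegG …)` the minute (H-core) lands.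
HONEST LABEL: (H-core) (LH5-p02 (g4)) is the one input not yet in the tree; HC_CM is proved only modulo the 7 printed citations (2 remaining: hLiu418 = `stmt-HodgeConjecture-24832`,
h413 = `stmt-HodgeConjecture-24833`) until rung 0 closes; this file is count-neutral letter-L1 (I₁) plumbing.

## References
* [Varadarajan1977] V. S. Varadarajan, *Harmonic Analysis on Real Reductive Groups*, LNM 576 (1977), Part I §1.12.
* [Shelstad1979] D. Shelstad, *Characters and inner forms of a quasi-split group over ℝ*, Compositio Math. 39 (1979), §4 property (II) p. 23, Lemma 4.3 (p. 25).
* [Bouaziz1994IntegralesOrbitales] A. Bouaziz, *Intégrales orbitales sur les groupes de Lie réductifs*, Ann. Sci. ÉNS 27 (1994), §3.1 (I₁)–(I₂) p. 579, §3.2 p. 580, §6.2 p. 591.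
* [Rogawski1990] J. D. Rogawski, *Automorphic Representations of Unitary Groups in Three Variables*, Ann. of Math. Stud. 123 (1990), §8.2 pp. 118–124.
-/

set_option autoImplicit false

noncomputable section

open Set Filter Topology Function MeasureTheory NumberField NumberField.InfinitePlace Complex Equiv
open scoped ContDiff MatrixGroups Matrix Classical Real Matrix.Norms.Operator

namespace Literature.NumberTheory.Rogawski1990

open Literature.NumberTheory.Automorphic Literature.NumberTheory.Automorphic.UnitaryGroup Literature.NumberTheory.Automorphic.ArchCartan
open Literature.Analysis.Calculus

/-! ## §1 The twisted flip under any same-sign transposition -/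

section Flip

variable (L : Type) [Field L] [NumberField L] (α : Fin 3 → L)

/-- **The compact reflection `(i k)` FLIPS the twisted member** (any same-sign transposition at a compact place `w₀ ∉ S`; ★ `twisted_hcSwapAt_zero_one` is `(0 1)`): under HC's (W)
clause, for `archRG S c ≠ 0`, `e^{ρ}_S(σc)·F_S(σc) = −e^{ρ}_S(c)·F_S(c)`, `σ = hcSwapAt w₀ i k` ((W): `F(σc)·R′(c) = R′(σc)·F(c)`; `e^{ρ}R′` alternates, ★ `archERhoG_mul_archRG_slotPerm`).
[cite: Shelstad1979, §4 property (II) p. 23] [cite: Bouaziz1994IntegralesOrbitales, §6.2 p. 591] -/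
theorem twisted_hcSwapAt_of_slotSign_eq {S : Finset {w : InfinitePlace L // IsComplex w}} {w₀ : {w : InfinitePlace L // IsComplex w}} (hw₀ : w₀ ∉ S) {i k : Fin 3} (hik : i ≠ k)
    (hs : slotSign L α w₀ i = slotSign L α w₀ k)
    {F : Finset {w : InfinitePlace L // IsComplex w} → ({w : InfinitePlace L // IsComplex w} → Fin 3 → ℝ) → ℂ} (hW : ArchHcWeyl (slotSign L α) F)
    {c : {w : InfinitePlace L // IsComplex w} → Fin 3 → ℝ} (hc : archRG S c ≠ 0) :
    archERhoG S (hcSwapAt w₀ i k c) * F S (hcSwapAt w₀ i k c) = -(archERhoG S c * F S c) := by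
  have hmem : Function.update (1 : {w : InfinitePlace L // IsComplex w} → Perm (Fin 3)) w₀ (swap i k) ∈ partnerPerms S :=
    (mem_partnerPerms_iff S _).2 fun w hw => by rw [Function.update_of_ne (by rintro rfl; exact hw₀ hw), Pi.one_apply]
  have hsw : slotPerm (Function.update (1 : {w : InfinitePlace L // IsComplex w} → Perm (Fin 3)) w₀ (swap i k)) c = hcSwapAt w₀ i k c :=
    slotPerm_update_one w₀ (swap i k) c
  have halt := archERhoG_mul_archRG_slotPerm hmem c
  have hsign : (∏ w, (Equiv.Perm.sign ((Function.update (1 : {w : InfinitePlace L // IsComplex w} → Perm (Fin 3)) w₀ (swap i k)) w) : ℂ)) = -1 := by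
    have h := prod_sign_update_swap_mul (1 : {w : InfinitePlace L // IsComplex w} → Perm (Fin 3)) w₀ hik
    simpa using h
  rw [hsw, hsign] at halt
  have hWeq := hW.1 S c w₀ i k hw₀ hik hs
  have hE : archERhoG S c ≠ 0 := archERhoG_ne_zero' S c
  refine mul_right_cancel₀ (mul_ne_zero hE hc) ?_
  linear_combination (archERhoG S (hcSwapAt w₀ i k c) * archERhoG S c) * hWeq + (archERhoG S c * F S c) * halt

end Flip

/-! ## §2 Generic transport of local jet bounds across a realised compact reflection -/

section Transport

variable {W : Type*} [Fintype W] [DecidableEq W]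

/-- **LOCAL JET BOUNDS ACROSS A REALISED COMPACT REFLECTION (generic).**  Let `F` be `C^∞` on the open `InRegG s S′`, let `σ = hcSwapAt w i k` (`w ∉ S′`, `s w i = s w k`, so `σ`
preserves `InRegG` and `RegG`), and let the twisted member flip on the `G`-regular set: `e^{ρ}(σc)F(σc) = −e^{ρ}(c)F(c)` for `c ∈ RegG S′`.  If the jets of `F` of orders `≤ n` are
bounded on `U_m ∩ InRegG` for neighbourhoods `U_m` of `σp`, then the order-`n` jet of `F` is bounded on `U ∩ InRegG` for a neighbourhood `U` of `p`.  PROOF: `F = u·(F∘σ)` on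
`RegG ∩ InRegG` with the global smooth unit `u = −e^{ρ}∘σ∕e^{ρ}` (★ `contDiff_archERhoG`, ★ `archERhoG_ne_zero'`); both sides continuous on `InRegG` and `RegG` dense (★ `dense_regG`,
Mathlib `Set.EqOn.of_subset_closure`) ⇒ equal on the open `InRegG` ⇒ equal jets there; `σ` is a continuous linear automorphism (★ `exists_continuousLinearEquiv_hcSwapAt`): ★
`bddAbove_norm_iteratedFDeriv_comp_affine` pulls the bounds back, ★ `bddAbove_norm_iteratedFDeriv_of_isCompact` bounds the unit's jets on a ball, ★ `bddAbove_norm_iteratedFDeriv_mul`.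
[cite: Shelstad1979, §4 property (II) p. 23; Lemma 4.3 (p. 25)] [cite: Varadarajan1977, Part I §1.12] [cite: Bouaziz1994IntegralesOrbitales, §3.2 (I₁) p. 579] -/
theorem exists_nhds_bddAbove_norm_iteratedFDeriv_of_twisted_flip (s : W → Fin 3 → SignType) (S' : Finset W) {w : W} (hw : w ∉ S')
    {i k : Fin 3} (hs : s w i = s w k) {F : (W → Fin 3 → ℝ) → ℂ} (hFs : ContDiffOn ℝ ∞ F (InRegG s S'))
    (hflip : ∀ c ∈ RegG S', archERhoG S' (hcSwapAt w i k c) * F (hcSwapAt w i k c) = -(archERhoG S' c * F c))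
    {p : W → Fin 3 → ℝ} {n : ℕ}
    (h : ∀ m ≤ n, ∃ U ∈ 𝓝 (hcSwapAt w i k p), BddAbove ((fun c => ‖iteratedFDeriv ℝ m F c‖) '' (U ∩ InRegG s S'))) :
    ∃ U ∈ 𝓝 p, BddAbove ((fun c => ‖iteratedFDeriv ℝ n F c‖) '' (U ∩ InRegG s S')) := by
  obtain ⟨A, hA⟩ := exists_continuousLinearEquiv_hcSwapAt (W := W) w i k
  -- the unit and the reflected member
  set u : (W → Fin 3 → ℝ) → ℂ := fun c => -(archERhoG S' (A c) * (archERhoG S' c)⁻¹) with hu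
  have hus : ContDiff ℝ ∞ u :=
    (((contDiff_archERhoG S').comp A.contDiff).mul ((contDiff_archERhoG S').inv fun c => archERhoG_ne_zero' S' c)).neg
  set G : (W → Fin 3 → ℝ) → ℂ := fun c => u c * F (A c) with hG
  have hAin : ∀ c, c ∈ InRegG s S' → A c ∈ InRegG s S' := fun c hc => by
    rw [hA]; exact (hcSwapAt_mem_inRegG_iff s S' hw hs c).2 hc
  have hFA : ContDiffOn ℝ ∞ (fun c => F (A c)) (InRegG s S') := hFs.comp A.contDiff.contDiffOn fun c hc => hAin c hc
  have hGs : ContDiffOn ℝ ∞ G (InRegG s S') := hus.contDiffOn.mul hFA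
  -- `F = G` on `InRegG ∩ RegG`, hence on the open `InRegG`
  have hEq0 : EqOn F G (InRegG s S' ∩ RegG S') := by
    intro c hc
    have hE : archERhoG S' c ≠ 0 := archERhoG_ne_zero' S' c
    have h' : archERhoG S' c * F c = -(archERhoG S' (hcSwapAt w i k c) * F (hcSwapAt w i k c)) := by
      rw [hflip c hc.2, neg_neg]
    calc F c = (archERhoG S' c)⁻¹ * (archERhoG S' c * F c) := by rw [← mul_assoc, inv_mul_cancel₀ hE, one_mul]
      _ = G c := by simp only [hG, hu, h', hA]; ring
  have hEq : EqOn F G (InRegG s S') :=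
    hEq0.of_subset_closure hFs.continuousOn hGs.continuousOn inter_subset_left
      ((dense_regG S').open_subset_closure_inter (isOpen_inRegG s S'))
  have hjet : ∀ (m : ℕ) (c : W → Fin 3 → ℝ), c ∈ InRegG s S' → iteratedFDeriv ℝ m F c = iteratedFDeriv ℝ m G c := fun m c hc =>
    ((hEq.eventuallyEq_of_mem ((isOpen_inRegG s S').mem_nhds hc)).iteratedFDeriv ℝ m).self_of_nhds
  -- neighbourhoods
  choose U hU hB using fun m : Fin (n + 1) => h m (Nat.lt_succ_iff.1 m.2)
  have hV : (⋂ m, U m) ∈ 𝓝 (hcSwapAt w i k p) := (Filter.iInter_mem).2 hU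
  have hVp : A ⁻¹' (⋂ m, U m) ∈ 𝓝 p := A.continuous.continuousAt.preimage_mem_nhds (by rw [hA]; exact hV)
  refine ⟨A ⁻¹' (⋂ m, U m) ∩ Metric.ball p 1, inter_mem hVp (Metric.ball_mem_nhds p one_pos), ?_⟩
  -- the bound for `G` on the piece
  have hpiece : BddAbove ((fun c => ‖iteratedFDeriv ℝ n G c‖) '' ((A ⁻¹' (⋂ m, U m) ∩ Metric.ball p 1) ∩ InRegG s S')) := by
    refine bddAbove_norm_iteratedFDeriv_mul (isOpen_inRegG s S') inter_subset_right hus.contDiffOn hFA (fun m _ => ?_) (fun m hm => ?_)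
    · exact (bddAbove_norm_iteratedFDeriv_of_isCompact isOpen_univ (isCompact_closedBall p 1) (subset_univ _) hus.contDiffOn m).mono
        (image_mono fun c hc => Metric.ball_subset_closedBall hc.1.2)
    · have hb := hB ⟨m, Nat.lt_succ_iff.2 hm⟩
      have h' : BddAbove ((fun y => ‖iteratedFDeriv ℝ m F y‖) '' ((fun y => A y + 0) '' ((A ⁻¹' (⋂ m, U m) ∩ Metric.ball p 1) ∩ InRegG s S'))) := by
        refine hb.mono (image_mono ?_)
        rintro _ ⟨c, hc, rfl⟩
        refine ⟨?_, ?_⟩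
        · simp only [add_zero]; exact mem_iInter.1 hc.1.1 ⟨m, Nat.lt_succ_iff.2 hm⟩
        · simp only [add_zero]; exact hAin c hc.2
      simpa only [add_zero] using bddAbove_norm_iteratedFDeriv_comp_affine A 0 h'
  have himg : (fun c => ‖iteratedFDeriv ℝ n F c‖) '' ((A ⁻¹' (⋂ m, U m) ∩ Metric.ball p 1) ∩ InRegG s S') =
      (fun c => ‖iteratedFDeriv ℝ n G c‖) '' ((A ⁻¹' (⋂ m, U m) ∩ Metric.ball p 1) ∩ InRegG s S') :=
    image_congr fun c hc => by rw [hjet n c hc.2]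
  rw [himg]
  exact hpiece

end Transport

/-! ## §3 The genuine family across the compact reflection -/

section Genuine

variable (L : Type) [Field L] [NumberField L] [IsCMField L] (α : Fin 3 → L)
  [MeasurableSpace ↥(arch (↥(maximalRealSubfield L)) L (IsCMField.complexConj L) 3 (Matrix.diagonal α))]
  [BorelSpace ↥(arch (↥(maximalRealSubfield L)) L (IsCMField.complexConj L) 3 (Matrix.diagonal α))]
  (ν' : Measure ↥(arch (↥(maximalRealSubfield L)) L (IsCMField.complexConj L) 3 (Matrix.diagonal α))) [ν'.IsHaarMeasure] [ν'.IsMulRightInvariant]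

/-- **(I₁) FACE BOUNDS OF THE GENUINE FAMILY ACROSS A REALISED COMPACT REFLECTION.**  On an admissible label `S` (frame `hα`, `hreal`; `a′ ∈ C_c^∞`), at a compact-chart place
`w ∉ S` and a same-sign pair `slotSign w i = slotSign w k`: if the jets of `orbFamGExt ν′ a′ S` of orders `≤ n` are locally bounded on `InRegG` near `hcSwapAt w i k p`, then its
order-`n` jet is locally bounded on `InRegG` near `p` (§2 with (W) ★ `archHcWeyl_orbFamGExt`, §1, (I₂) ★ `contDiffOn_orbFamGExt_inRegG`).
[cite: Shelstad1979, §4 property (II) p. 23; Lemma 4.3 (p. 25)] [cite: Varadarajan1977, Part I §1.12] [cite: Bouaziz1994IntegralesOrbitales, §3.1 (I₁)–(I₂) p. 579] -/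
theorem exists_nhds_bddAbove_norm_iteratedFDeriv_orbFamGExt_of_hcSwapAt (hα : ∀ i, α i ≠ 0)
    (hreal : ∀ (w : {w : InfinitePlace L // IsComplex w}) (i : Fin 3), (w.1.embedding (α i)).im = 0)
    {S : Finset {w : InfinitePlace L // IsComplex w}} (hS : ∀ w, w ∈ S → w ∈ splitChartPlaces L α)
    {a' : ↥(arch (↥(maximalRealSubfield L)) L (IsCMField.complexConj L) 3 (Matrix.diagonal α)) → ℂ} (ha' : ArchSmooth L 3 (Matrix.diagonal α) a')
    {w : {w : InfinitePlace L // IsComplex w}} (hw : w ∉ S) {i k : Fin 3} (hik : i ≠ k) (hs : slotSign L α w i = slotSign L α w k)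
    {p : {w : InfinitePlace L // IsComplex w} → Fin 3 → ℝ} {n : ℕ}
    (h : ∀ m ≤ n, ∃ U ∈ 𝓝 (hcSwapAt w i k p), BddAbove ((fun c => ‖iteratedFDeriv ℝ m (orbFamGExt L α ν' a' S) c‖) '' (U ∩ InRegG (slotSign L α) S))) :
    ∃ U ∈ 𝓝 p, BddAbove ((fun c => ‖iteratedFDeriv ℝ n (orbFamGExt L α ν' a' S) c‖) '' (U ∩ InRegG (slotSign L α) S)) :=
  exists_nhds_bddAbove_norm_iteratedFDeriv_of_twisted_flip (slotSign L α) S hw hs (contDiffOn_orbFamGExt_inRegG L α ν' S hα hreal hS ha')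
    (fun _ hc => twisted_hcSwapAt_of_slotSign_eq L α hw hik hs (archHcWeyl_orbFamGExt L α ν' hα hreal a') (archRG_ne_zero_of_mem_regG hc)) h

/-! ## §4 The socket reduction: the whole `hF` of ★ `smoothBounded_orbFamGExt_of_strata₄` from the `(0,2)`-heads -/

/-- **THE `hF` SOCKET OF ★ `smoothBounded_orbFamGExt_of_strata₄` FROM THE `(0,2)`-HEADS.**  If at every ADMISSIBLE label `S′`, every compact-chart place `w ∉ S′` with
`slotSign w 0 ≠ slotSign w 2` and every one-wall point `x` of the wall `(w, 0, 2)` the jets of `orbFamGExt ν′ a′ S′` are locally bounded on `InRegG` (`h02`), then the full face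
socket holds: every label (junk labels: the family is `0`, ★ `orbFamGExt_of_not_admissible`), every noncompact pair `(i, j)` (a place with two slot signs is a split-chart place, ★
`mem_splitChartPlaces_of_isIndefiniteAt`, where the slot signs read `(s, s, −s)`, ★ `slotSign_of_mem_splitChartPlaces`: `(0,1)∕(1,0)` are compact — excluded by the socket's sign
hypothesis; `(0,2)∕(2,0)` are `h02`; `(1,2)∕(2,1)` are carried onto `(0,2)` at the reflected point `hcSwapAt w 0 1 x` by §3).  The cube hypothesis of the socket is not used.
[cite: Shelstad1979, §4 property (II) p. 23; Lemma 4.3 (p. 25)] [cite: Varadarajan1977, Part I §1.12] [cite: Bouaziz1994IntegralesOrbitales, §3.1 (I₁)–(I₂) p. 579; §3.2 p. 580] -/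
theorem faceJetBounds_of_wall02 (hα : ∀ i, α i ≠ 0)
    (hreal : ∀ (w : {w : InfinitePlace L // IsComplex w}) (i : Fin 3), (w.1.embedding (α i)).im = 0)
    {a' : ↥(arch (↥(maximalRealSubfield L)) L (IsCMField.complexConj L) 3 (Matrix.diagonal α)) → ℂ} (ha' : ArchSmooth L 3 (Matrix.diagonal α) a')
    (h02 : ∀ (S' : Finset {w : InfinitePlace L // IsComplex w}), (∀ w, w ∈ S' → w ∈ splitChartPlaces L α) → ∀ (n : ℕ) (x : {w : InfinitePlace L // IsComplex w} → Fin 3 → ℝ) (w : {w : InfinitePlace L // IsComplex w}), w ∉ S' →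
      slotSign L α w 0 ≠ slotSign L α w 2 → x w 0 = x w 2 → Circle.exp (x w (hcThird 0 2)) ≠ Circle.exp (x w 0) →
      (∀ w', w' ∉ S' → w' ≠ w → ∀ i' j' : Fin 3, i' ≠ j' → slotSign L α w' i' ≠ slotSign L α w' j' → Circle.exp (x w' i') ≠ Circle.exp (x w' j')) →
      ∃ U ∈ 𝓝 x, BddAbove ((fun c => ‖iteratedFDeriv ℝ n (orbFamGExt L α ν' a' S') c‖) '' (U ∩ InRegG (slotSign L α) S'))) :
    ∀ (S' : Finset {w : InfinitePlace L // IsComplex w}) (n : ℕ) (x : {w : InfinitePlace L // IsComplex w} → Fin 3 → ℝ) (w : {w : InfinitePlace L // IsComplex w}) (i j : Fin 3),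
      (∀ w' : {w : InfinitePlace L // IsComplex w}, w' ∉ S' → ∀ l : Fin 3, x w' l ∈ Ico 0 (2 * π)) →
      w ∉ S' → i ≠ j → slotSign L α w i ≠ slotSign L α w j → x w i = x w j →
        Circle.exp (x w (hcThird i j)) ≠ Circle.exp (x w i) →
        (∀ w', w' ∉ S' → w' ≠ w → ∀ i' j' : Fin 3, i' ≠ j' → slotSign L α w' i' ≠ slotSign L α w' j' → Circle.exp (x w' i') ≠ Circle.exp (x w' j')) →
        ∃ U ∈ 𝓝 x, BddAbove ((fun c => ‖iteratedFDeriv ℝ n (orbFamGExt L α ν' a' S') c‖) '' (U ∩ InRegG (slotSign L α) S')) := by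
  intro S' n x w i j _ hw hij hsij hx hxk hxin
  by_cases hS' : ∀ w, w ∈ S' → w ∈ splitChartPlaces L α
  swap
  · -- junk label: the family vanishes
    refine ⟨univ, univ_mem, 0, ?_⟩
    rintro _ ⟨c, -, rfl⟩
    show ‖iteratedFDeriv ℝ n (orbFamGExt L α ν' a' S') c‖ ≤ 0
    rw [orbFamGExt_of_not_admissible L α ν' a' S' hS', iteratedFDeriv_fun_zero, Pi.zero_apply, norm_zero]
  -- admissible label: the place is a split-chart place, slot signs `(s, s, −s)`
  have hind : IsIndefiniteAt (slotSign L α) w := by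
    intro hdef
    have h0 : ∀ l : Fin 3, slotSign L α w l = slotSign L α w 0 := by
      intro l
      fin_cases l
      · rfl
      · exact hdef.1.symm
      · exact hdef.2.symm.trans hdef.1.symm
    exact hsij (by rw [h0 i, h0 j])
  have hwsp : w ∈ splitChartPlaces L α := mem_splitChartPlaces_of_isIndefiniteAt L α hα (hreal w) hind
  obtain ⟨h10, -, -⟩ := slotSign_of_mem_splitChartPlaces L α hα hwsp
  have h02s : slotSign L α w 0 ≠ slotSign L α w 2 := (slotSign_zero_ne_two_of_mem_splitChartPlaces L α hα hwsp).1
  -- the `(0,2)`-head at any one-wall point `y` of the wall `(w,0,2)`, all orders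
  have hA : ∀ y : {w : InfinitePlace L // IsComplex w} → Fin 3 → ℝ, y w 0 = y w 2 → Circle.exp (y w 1) ≠ Circle.exp (y w 0) →
      (∀ w', w' ∉ S' → w' ≠ w → ∀ i' j' : Fin 3, i' ≠ j' → slotSign L α w' i' ≠ slotSign L α w' j' → Circle.exp (y w' i') ≠ Circle.exp (y w' j')) →
      ∀ m : ℕ, ∃ U ∈ 𝓝 y, BddAbove ((fun c => ‖iteratedFDeriv ℝ m (orbFamGExt L α ν' a' S') c‖) '' (U ∩ InRegG (slotSign L α) S')) := fun y hy hyk hyin m =>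
    h02 S' hS' m y w hw h02s hy (by rwa [hcThird_zero_two]) hyin
  -- the `(1,2)`-wall: reflect by `hcSwapAt w 0 1` (a SAME-sign transposition) onto the `(0,2)`-wall
  have hB : ∀ y : {w : InfinitePlace L // IsComplex w} → Fin 3 → ℝ, y w 1 = y w 2 → Circle.exp (y w 0) ≠ Circle.exp (y w 1) →
      (∀ w', w' ∉ S' → w' ≠ w → ∀ i' j' : Fin 3, i' ≠ j' → slotSign L α w' i' ≠ slotSign L α w' j' → Circle.exp (y w' i') ≠ Circle.exp (y w' j')) →
      ∀ m : ℕ, ∃ U ∈ 𝓝 y, BddAbove ((fun c => ‖iteratedFDeriv ℝ m (orbFamGExt L α ν' a' S') c‖) '' (U ∩ InRegG (slotSign L α) S')) := by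
    intro y hy hyk hyin m
    refine exists_nhds_bddAbove_norm_iteratedFDeriv_orbFamGExt_of_hcSwapAt L α ν' hα hreal hS' ha' hw (show (0 : Fin 3) ≠ 1 by decide) h10.symm
      (fun m' _ => hA (hcSwapAt w 0 1 y) ?_ ?_ ?_ m')
    · rw [(hcSwapAt_apply_pair w 0 1 y).1, hcSwapAt_apply_self_of_ne w (show (2 : Fin 3) ≠ 0 by decide) (show (2 : Fin 3) ≠ 1 by decide)]
      exact hy
    · rw [(hcSwapAt_apply_pair w 0 1 y).2, (hcSwapAt_apply_pair w 0 1 y).1]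
      exact hyk
    · intro w' hw' hne i' j' hij' hs'
      rw [hcSwapAt_apply_of_ne hne]
      exact hyin w' hw' hne i' j' hij' hs'
  -- the six ordered pairs
  have hi : i = 0 ∨ i = 1 ∨ i = 2 := by fin_cases i <;> simp
  have hj : j = 0 ∨ j = 1 ∨ j = 2 := by fin_cases j <;> simp
  rcases hi with rfl | rfl | rfl <;> rcases hj with rfl | rfl | rfl
  · exact absurd rfl hij
  · exact absurd h10.symm hsij
  · exact hA x hx (by simpa only [hcThird_zero_two] using hxk) hxin n
  · exact absurd h10 hsij
  · exact absurd rfl hij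
  · exact hB x hx (by simpa only [hcThird_one_two] using hxk) hxin n
  · refine hA x hx.symm ?_ hxin n
    have h3 : hcThird (2 : Fin 3) 0 = 1 := by decide
    rw [h3, hx] at hxk
    exact hxk
  · refine hB x hx.symm ?_ hxin n
    have h3 : hcThird (2 : Fin 3) 1 = 0 := by decide
    rw [h3, hx] at hxk
    exact hxk
  · exact absurd rfl hij

/-! ## §5 O-L1c from the (B-desc′) head alone -/

/-- **O-L1c `hF` FROM THE (B-desc′) BOX DESCENT ALONE.**  If at every admissible label `S`, every split-chart place `w₀ ∉ S` and every one-wall base point `x` of the wall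
`(w₀, 0, 2)` the extended family admits a (B-desc′) box package — the HEAD SHAPE `hbox` of LH7-p02 (g4)'s EDITION 2 `exists_descent_box_orbFamGExt_inRegG` (= ★ p851168
`…_of_corePackage` ∘ (H-core), conclusion text verbatim) — then the whole `hF` socket of ★ `smoothBounded_orbFamGExt_of_strata₄` holds: §4 ∘ ★ `…_of_boxPackage` (the Cayley
`U(J)` carrier `hJ`, `μ₀` any two-sided Haar measure).  The leaf pays O-L1c by `faceJetBounds_of_boxDescent … (fun S hS w₀ hw₀ hwsp x hx02 hx1 hxin => exists_descent_box_orbFamGExt_inRegG …)`.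
[cite: Varadarajan1977, Part I §1.12] [cite: Bouaziz1994IntegralesOrbitales, §3.1 (I₁)–(I₂) p. 579; §3.2 p. 580] [cite: Shelstad1979, §4 pp. 22–25] [cite: Rogawski1990, §8.2 pp. 118–124] -/
theorem faceJetBounds_of_boxDescent (hα : ∀ i, α i ≠ 0)
    (hreal : ∀ (w : {w : InfinitePlace L // IsComplex w}) (i : Fin 3), (w.1.embedding (α i)).im = 0)
    {J : Matrix (Fin 2) (Fin 2) ℂ} (hJ : J = (StdForm.antidiagonal 2).over ℂ)
    [MeasurableSpace ↥(unitaryGroupOfForm (starRingEnd ℂ) J)] [BorelSpace ↥(unitaryGroupOfForm (starRingEnd ℂ) J)]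
    [LocallyCompactSpace ↥(unitaryGroupOfForm (starRingEnd ℂ) J)] [SecondCountableTopology ↥(unitaryGroupOfForm (starRingEnd ℂ) J)]
    (μ₀ : Measure ↥(unitaryGroupOfForm (starRingEnd ℂ) J)) [μ₀.IsHaarMeasure] [μ₀.IsMulRightInvariant]
    {a' : ↥(arch (↥(maximalRealSubfield L)) L (IsCMField.complexConj L) 3 (Matrix.diagonal α)) → ℂ} (ha' : ArchSmooth L 3 (Matrix.diagonal α) a')
    (hbox : ∀ (S : Finset {w : InfinitePlace L // IsComplex w}), (∀ w, w ∈ S → w ∈ splitChartPlaces L α) → ∀ (w₀ : {w : InfinitePlace L // IsComplex w}), w₀ ∉ S → w₀ ∈ splitChartPlaces L α →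
      ∀ (x : {w : InfinitePlace L // IsComplex w} → Fin 3 → ℝ), x w₀ 0 = x w₀ 2 → Circle.exp (x w₀ 1) ≠ Circle.exp (x w₀ 0) →
      (∀ w', w' ∉ S → w' ≠ w₀ → ∀ i' j' : Fin 3, i' ≠ j' → slotSign L α w' i' ≠ slotSign L α w' j' → Circle.exp (x w' i') ≠ Circle.exp (x w' j')) →
      ∃ (K : ℂ) (U : Set ({w : InfinitePlace L // IsComplex w} → Fin 3 → ℝ)) (f : ({w : InfinitePlace L // IsComplex w} → Fin 3 → ℝ) × Matrix (Fin 2) (Fin 2) ℂ → ℂ),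
      K ≠ 0 ∧ IsOpen U ∧ x ∈ U ∧ ContDiff ℝ ∞ f ∧
      (∃ C : Set (Matrix (Fin 2) (Fin 2) ℂ), IsCompact C ∧ ∀ c X, X ∉ C → f (c, X) = 0) ∧
      (∀ c X, f (c, X) = f (Function.update c w₀ ![0, c w₀ 1, 0], X)) ∧
      (∀ c ∈ U, Circle.exp (c w₀ 0) ≠ Circle.exp (c w₀ 2) → c ∈ InRegG (slotSign L α) S) ∧
      ∀ c ∈ U, Circle.exp (c w₀ 0) ≠ Circle.exp (c w₀ 2) →
        orbFamGExt L α ν' a' S c =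
          (1 - (Circle.exp (c w₀ 1 - c w₀ 0) : ℂ)) * (1 - (Circle.exp (c w₀ 2 - c w₀ 0) : ℂ)) * (1 - (Circle.exp (c w₀ 2 - c w₀ 1) : ℂ)) *
          (K * ∫ h : ↥(unitaryGroupOfForm (starRingEnd ℂ) J),
            f (c, (((h * ⟨Matrix.GeneralLinearGroup.mkOfDetNeZero !![(1 : ℂ), 1; 1, -1] det_cayleyTwo_ne_zero *
                  circleDiagonal 2 ![Circle.exp (c w₀ 0), Circle.exp (c w₀ 2)] *
                  (Matrix.GeneralLinearGroup.mkOfDetNeZero !![(1 : ℂ), 1; 1, -1] det_cayleyTwo_ne_zero)⁻¹,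
                cayley_conj_circleDiagonal_mem_of_eq_over hJ _⟩ * h⁻¹ : ↥(unitaryGroupOfForm (starRingEnd ℂ) J)) : GL (Fin 2) ℂ) : Matrix (Fin 2) (Fin 2) ℂ)) ∂μ₀)) :
    ∀ (S' : Finset {w : InfinitePlace L // IsComplex w}) (n : ℕ) (x : {w : InfinitePlace L // IsComplex w} → Fin 3 → ℝ) (w : {w : InfinitePlace L // IsComplex w}) (i j : Fin 3),
      (∀ w' : {w : InfinitePlace L // IsComplex w}, w' ∉ S' → ∀ l : Fin 3, x w' l ∈ Ico 0 (2 * π)) →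
      w ∉ S' → i ≠ j → slotSign L α w i ≠ slotSign L α w j → x w i = x w j →
        Circle.exp (x w (hcThird i j)) ≠ Circle.exp (x w i) →
        (∀ w', w' ∉ S' → w' ≠ w → ∀ i' j' : Fin 3, i' ≠ j' → slotSign L α w' i' ≠ slotSign L α w' j' → Circle.exp (x w' i') ≠ Circle.exp (x w' j')) →
        ∃ U ∈ 𝓝 x, BddAbove ((fun c => ‖iteratedFDeriv ℝ n (orbFamGExt L α ν' a' S') c‖) '' (U ∩ InRegG (slotSign L α) S')) :=
  faceJetBounds_of_wall02 L α ν' hα hreal ha' fun S' hS' n x w hw hs hx hxk hxin =>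
    exists_nhds_bddAbove_norm_iteratedFDeriv_orbFamGExt_of_boxPackage L α ν' hJ μ₀ hw hs hx hxk hxin
      (hbox S' hS' w hw
        (mem_splitChartPlaces_of_isIndefiniteAt L α hα (hreal w) fun hdef => hs (hdef.1.trans hdef.2))
        x hx (by rwa [hcThird_zero_two] at hxk) hxin) n

/-! ## §6 EDITION 2 — THE FRAME FORM: O-L1c from the (B-desc′) head over the house frame `(hherm, hanis)`, Cayley carrier and Haar measure built inside -/

/-- **O-L1c `hF` IN THE LEAF'S FRAME, FROM THE (B-desc′) HEAD ALONE (EDITION 2).**  Same as §5 `faceJetBounds_of_boxDescent`, but in the binders of the leaf's `L1Frame`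
(`hherm`, `hanis` instead of `hα`, `hreal`: ★ `ne_zero_of_diagonal_anisotropic`, ★ `complexConj_apply_eq_of_diagonal_frame`, ★ `im_embedding_diagonal_eq_zero`) and with NO carrier
binder: the standard rank-one Cayley carrier `U(J)`, `J = Φ₂ ⊗ ℂ`, its Borel structure (★ `locallyCompactSpace_unitaryGroupOfForm_complex`, ★ `secondCountableTopology_unitaryGroupOfForm_complex`)
and a two-sided Haar measure `μ₀` (★ `sharedRankOneDatum_exists`) are produced INSIDE, and the (B-desc′) head is consumed UNIVERSALLY in the carrier (`hbox` quantifies over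
`J, hJ`, the four instances and `μ₀` with its two instances — exactly the binder block of LH5-p02 (g4)'s EDITION 2 head `exists_descent_box_orbFamGExt_inRegG`).  So the leaf pays
O-L1c by `fun L _ _ _ α _ _ ν' _ _ hherm hanis a' ha' => faceJetBounds_of_boxDescent_frame L α ν' hherm hanis ha' (fun hJ _ _ _ _ μ₀ _ _ S hS w₀ hw₀ hwsp x hx02 hx1 hxin =>
exists_descent_box_orbFamGExt_inRegG …)` — and EDITION 3 of this file will be that term, hypothesis-free, the minute (H-core) lands.
[cite: Varadarajan1977, Part I §1.12] [cite: Bouaziz1994IntegralesOrbitales, §3.1 (I₁)–(I₂) p. 579; §3.2 p. 580] [cite: Shelstad1979, §4 pp. 22–25] [cite: Rogawski1990, §8.2 pp. 118–124] -/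
theorem faceJetBounds_of_boxDescent_frame
    (hherm : ((Matrix.diagonal α).map (cmConjRingHom L)).transpose = Matrix.diagonal α)
    (hanis : ∀ x : Fin 3 → L, Literature.AlgebraicGeometry.ShimuraVarieties.hermForm (cmConjRingHom L) (Matrix.diagonal α) x x = 0 → x = 0)
    {a' : ↥(arch (↥(maximalRealSubfield L)) L (IsCMField.complexConj L) 3 (Matrix.diagonal α)) → ℂ} (ha' : ArchSmooth L 3 (Matrix.diagonal α) a')
    (hbox : ∀ {J : Matrix (Fin 2) (Fin 2) ℂ} (hJ : J = (StdForm.antidiagonal 2).over ℂ)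
      [MeasurableSpace ↥(unitaryGroupOfForm (starRingEnd ℂ) J)] [BorelSpace ↥(unitaryGroupOfForm (starRingEnd ℂ) J)] [LocallyCompactSpace ↥(unitaryGroupOfForm (starRingEnd ℂ) J)] [SecondCountableTopology ↥(unitaryGroupOfForm (starRingEnd ℂ) J)]
      (μ₀ : Measure ↥(unitaryGroupOfForm (starRingEnd ℂ) J)) [μ₀.IsHaarMeasure] [μ₀.IsMulRightInvariant],
      ∀ (S : Finset {w : InfinitePlace L // IsComplex w}), (∀ w, w ∈ S → w ∈ splitChartPlaces L α) → ∀ (w₀ : {w : InfinitePlace L // IsComplex w}), w₀ ∉ S → w₀ ∈ splitChartPlaces L α →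
      ∀ (x : {w : InfinitePlace L // IsComplex w} → Fin 3 → ℝ), x w₀ 0 = x w₀ 2 → Circle.exp (x w₀ 1) ≠ Circle.exp (x w₀ 0) →
      (∀ w', w' ∉ S → w' ≠ w₀ → ∀ i' j' : Fin 3, i' ≠ j' → slotSign L α w' i' ≠ slotSign L α w' j' → Circle.exp (x w' i') ≠ Circle.exp (x w' j')) →
      ∃ (K : ℂ) (U : Set ({w : InfinitePlace L // IsComplex w} → Fin 3 → ℝ)) (f : ({w : InfinitePlace L // IsComplex w} → Fin 3 → ℝ) × Matrix (Fin 2) (Fin 2) ℂ → ℂ),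
      K ≠ 0 ∧ IsOpen U ∧ x ∈ U ∧ ContDiff ℝ ∞ f ∧
      (∃ C : Set (Matrix (Fin 2) (Fin 2) ℂ), IsCompact C ∧ ∀ c X, X ∉ C → f (c, X) = 0) ∧
      (∀ c X, f (c, X) = f (Function.update c w₀ ![0, c w₀ 1, 0], X)) ∧
      (∀ c ∈ U, Circle.exp (c w₀ 0) ≠ Circle.exp (c w₀ 2) → c ∈ InRegG (slotSign L α) S) ∧
      ∀ c ∈ U, Circle.exp (c w₀ 0) ≠ Circle.exp (c w₀ 2) →
        orbFamGExt L α ν' a' S c =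
          (1 - (Circle.exp (c w₀ 1 - c w₀ 0) : ℂ)) * (1 - (Circle.exp (c w₀ 2 - c w₀ 0) : ℂ)) * (1 - (Circle.exp (c w₀ 2 - c w₀ 1) : ℂ)) *
          (K * ∫ h : ↥(unitaryGroupOfForm (starRingEnd ℂ) J),
            f (c, (((h * ⟨Matrix.GeneralLinearGroup.mkOfDetNeZero !![(1 : ℂ), 1; 1, -1] det_cayleyTwo_ne_zero *
                  circleDiagonal 2 ![Circle.exp (c w₀ 0), Circle.exp (c w₀ 2)] *
                  (Matrix.GeneralLinearGroup.mkOfDetNeZero !![(1 : ℂ), 1; 1, -1] det_cayleyTwo_ne_zero)⁻¹,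
                cayley_conj_circleDiagonal_mem_of_eq_over hJ _⟩ * h⁻¹ : ↥(unitaryGroupOfForm (starRingEnd ℂ) J)) : GL (Fin 2) ℂ) : Matrix (Fin 2) (Fin 2) ℂ)) ∂μ₀)) :
    ∀ (S' : Finset {w : InfinitePlace L // IsComplex w}) (n : ℕ) (x : {w : InfinitePlace L // IsComplex w} → Fin 3 → ℝ) (w : {w : InfinitePlace L // IsComplex w}) (i j : Fin 3),
      (∀ w' : {w : InfinitePlace L // IsComplex w}, w' ∉ S' → ∀ l : Fin 3, x w' l ∈ Ico 0 (2 * π)) →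
      w ∉ S' → i ≠ j → slotSign L α w i ≠ slotSign L α w j → x w i = x w j →
        Circle.exp (x w (hcThird i j)) ≠ Circle.exp (x w i) →
        (∀ w', w' ∉ S' → w' ≠ w → ∀ i' j' : Fin 3, i' ≠ j' → slotSign L α w' i' ≠ slotSign L α w' j' → Circle.exp (x w' i') ≠ Circle.exp (x w' j')) →
        ∃ U ∈ 𝓝 x, BddAbove ((fun c => ‖iteratedFDeriv ℝ n (orbFamGExt L α ν' a' S') c‖) '' (U ∩ InRegG (slotSign L α) S')) := by
  -- the frame
  have hα : ∀ i, α i ≠ 0 := ne_zero_of_diagonal_anisotropic hanis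
  have hreal : ∀ (w' : {w : InfinitePlace L // IsComplex w}) (i : Fin 3), (w'.1.embedding (α i)).im = 0 :=
    im_embedding_diagonal_eq_zero L 3 α (complexConj_apply_eq_of_diagonal_frame hherm)
  -- the standard rank-one Cayley carrier `U(J)` with a two-sided Haar measure
  obtain ⟨J, hJ⟩ : ∃ J : Matrix (Fin 2) (Fin 2) ℂ, J = (StdForm.antidiagonal 2).over ℂ := ⟨_, rfl⟩
  letI : MeasurableSpace ↥(unitaryGroupOfForm (starRingEnd ℂ) J) := borel _
  haveI : BorelSpace ↥(unitaryGroupOfForm (starRingEnd ℂ) J) := ⟨rfl⟩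
  haveI : LocallyCompactSpace ↥(unitaryGroupOfForm (starRingEnd ℂ) J) := locallyCompactSpace_unitaryGroupOfForm_complex J
  haveI : SecondCountableTopology ↥(unitaryGroupOfForm (starRingEnd ℂ) J) := secondCountableTopology_unitaryGroupOfForm_complex J
  letI : MeasurableSpace (↥(unitaryGroupOfForm (starRingEnd ℂ) J) ⧸ torusU (starRingEnd ℂ) J) := borel _
  haveI : BorelSpace (↥(unitaryGroupOfForm (starRingEnd ℂ) J) ⧸ torusU (starRingEnd ℂ) J) := ⟨rfl⟩
  obtain ⟨μ₀, hμ₀H, hμ₀R, -⟩ := sharedRankOneDatum_exists hJ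
  haveI := hμ₀H
  haveI := hμ₀R
  exact faceJetBounds_of_boxDescent L α ν' hα hreal hJ μ₀ ha' (hbox hJ μ₀)

end Genuine

end Literature.NumberTheory.Rogawski1990

end
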